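import Literature.Analysis.Matrix.ConjugateGradientConvergence
import Literature.Analysis.Matrix.ResidualErrorBound
import Literature.LinearAlgebra.Matrix.DeflationProjectors
import HarnessLib

/-!
# Deflated conjugate gradients: the deflated matrix `A π_R`, its spectrum, the deflated start,
# and the `√κ_eff` rate with `κ_eff = λ_max/λ_{k+1}`

Topic `Analysis/Matrix`; sequel of `ConjugateGradientConvergence.lean` (Saad's Galerkin–Krylov
iterate `IsCGIterate`, its `A`-norm optimality and `√κ` rate) and of
`Literature/LinearAlgebra/Matrix/DeflationProjectors.lean` (Lüscher's `π_L`, `π_R`, the little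
operator `E = Vᵀ A V` and the coarse correction `V E⁻¹ Vᵀ`).  PUBLISHED RESULTS with our proofs;
no named fact (`def … : Prop`) is introduced (D-0026).  Wanted by the cell pub-lqcd (venture
`LatticeQCDFlow`; HOME/R2-SCOPE.md §1 "a solve", §3 E7 and §4 cost classes: the iteration count
of one solve is governed by `√κ`, `κ = λ_max/λ_min(D†D) ∝ (a m_q)⁻²`; deflating the modes below
`λ_{k+1}` replaces `κ` by `κ_eff = λ_max/λ_{k+1}` — the mechanism behind low-mode deflation /
multigrid solvers in lattice QCD; FANOUT row 38).

## Sources (read on the materialised texts) and what is taken from each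

* Y. Saad, M. Yeung, J. Erhel, F. Guyomarc'h, *A deflated version of the conjugate gradient
  algorithm*, SIAM J. Sci. Comput. 21 (2000) 1909–1926 [SaadEtAl2000] (held text
  `paper:doi-10-1137-s1064829598339761`): §2 eq. (2.3) "the auxiliary matrix
  `B := A − AW(WᵀAW)⁻¹WᵀA` … is symmetric but not necessarily positive definite … noting that
  `WᵀB = 0`" (p. 1910); §3 (3.2)–(3.3) "Assume an initial guess `x₀` … is given such that
  `r₀ := b − Ax₀ ⊥ W`" and eq. (3.12) "To guarantee that the initial guess `x₀` satisfies
  `Wᵀr₀ = 0`, we can choose `x₀` in the form `x₀ = x₋₁ + W(WᵀAW)⁻¹Wᵀr₋₁` where `x₋₁` is arbitrary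
  and `r₋₁ := b − Ax₋₁`. In fact, `x₀` with `Wᵀr₀ = 0` must have the form (3.12)" (p. 1914);
  §4 "`H = I − W(WᵀAW)⁻¹(AW)ᵀ` … `Hᵀ = I − AW(WᵀAW)⁻¹Wᵀ` … `AH = HᵀA = HᵀAH` (4.1)",
  Proposition 4.1 ("the Petrov–Galerkin condition `r₀ ⊥ W` and `r_j ⊥ 𝒦_{k,j}(A, W, r₀)`" (4.3)),
  Theorem 4.3 "Let `κ` be the condition number of `HᵀAH`. Then
  `‖x* − x_j‖_A ≤ 2((√κ − 1)/(√κ + 1))^j ‖x* − x₀‖_A` (4.4)" (pp. 1915–1916); §5 "In the special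
  case where the column vectors `w₁, …, w_k` of `W` are exact eigenvectors of `A` associated with
  the smallest eigenvalues `λ₁, …, λ_k`, then clearly `κ(HᵀAH) = λ_n/λ_{k+1}`" (p. 1917).
* K. Kahl, H. Rittich, *The deflated conjugate gradient method: convergence, perturbation and
  accuracy*, Linear Algebra Appl. 515 (2017) 111–129 = arXiv:1209.1963 [KahlRittich2017] (held
  text `paper:arxiv-1209.1963`): §2 eqs. (2.2)–(2.3) (`π_A(𝒮) x = V(V^*AV)⁻¹V^*A x =
  V(V^*AV)⁻¹V^*b`), Lemma 1, "`‖e_i‖_A ≤ 2((√κ_eff − 1)/(√κ_eff + 1))^i ‖e₀‖_A` … where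
  `κ_eff = μ₁/μ_ℓ`" (chunk p0005–p0006); §3.1 "`μ₁ ≤ … = λ₁ = ‖A‖` (3.1)", Lemma 2 and "the kernel
  of `A(I − π_A(𝒮))` is the kernel of `(I − π_A(𝒮))` which is the deflation subspace `𝒮`",
  eq. (3.3) `μ_ℓ = min_{x ∈ 𝒮^⊥∖{0}} ‖(I − π_A(𝒮))x‖_A²/‖x‖₂²` (chunk p0007); §3.2 Definition 1
  (weak approximation property `dist(𝒮, x)₂² ≤ (K/‖A‖) ‖x‖_A²`), Lemma 3 (the `C`-form
  `‖x − VRx‖₂² ≤ C ‖x‖_A²`, `K = C‖A‖`), **Theorem 1** `κ_eff ≤ K/ξ` (chunk p0008); §3.3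
  eq. (3.9)–(3.12) (strengthened Cauchy–Schwarz inequality with constant `γ ∈ [0,1)` between
  `𝒮^⊥` and `𝒮` in the `A`-inner product, `ξ ≥ 1 − γ`), Lemma 4 (`A𝒮 = 𝒮 ⇒ γ = 0`),
  **Theorem 2** `κ_eff ≤ K/(1 − γ)` (chunk p0009); §4.1 (exact eigenvectors: `K = λ₁/λ_k`,
  `γ = 0`, "the bound is equal to the effective condition number `κ_eff` and thus best possible")
  (chunk p0010).
* J. Frank, C. Vuik, SIAM J. Sci. Comput. 23 (2001) 442–462 (the eigenvector case
  `κ_eff = λ₁/λ_k`) — cited THROUGH [KahlRittich2017, §4.1] and [SaadEtAl2000, §5]; not read.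

## What is formalised (all proved; real symmetric matrices, exact arithmetic)

`A : Matrix ι ι ℝ` symmetric (positive (semi)definite where stated), `V : Matrix ι k ℝ` the matrix
of deflation vectors (Saad's `W`, Kahl–Rittich's `V`), little operator `E = Vᵀ A V` with
`IsUnit E.det`, `π_R = 1 − V E⁻¹ Vᵀ A = H = I − π_A(𝒮)`, `π_L = π_Rᵀ = Hᵀ`.
* §1 `transpose_piR`, `mul_piR_eq_transpose_mul_mul` (`AH = HᵀAH`), `isHermitian_mul_piR`,
  `posSemidef_mul_piR`, the quadratic form `xᵀ(Aπ_R)x = ‖π_R x‖_A²`, the `A`-orthogonal splitting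
  `‖x‖_A² = ‖π_R x‖_A² + ‖(1 − π_R)x‖_A²` and `‖π_R x‖_A² ≤ ‖x‖_A²`; eigenvalue facts of the
  deflated matrix `A π_R`: every eigenvalue lies in `[0, λ_max(A)]` (3.1), the kernel is the
  deflation subspace, eigenvectors of non-zero eigenvalues are orthogonal to it, and
  **Theorems 1–2** in `C`-form: under the weak approximation property with constant `C` and the
  strengthened Cauchy–Schwarz constant `γ ∈ [0, 1)`, every non-zero eigenvalue is `≥ (1 − γ)/C`
  (so `κ_eff ≤ λ_max C/(1 − γ) = K/(1 − γ)`); Lemma 4 (`A`-invariant subspace ⇒ `γ = 0`).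
* §2 exact eigenvector deflation (`V = eigMatrix hA e`, columns = orthonormal eigenvectors
  `q_{e j}`): `E = diag(λ_{e j})`, and the spectrum of `A π_R` is `{0 (deflated), λ_i (others)}`
  on the eigenbasis — Saad et al.'s "clearly `κ(HᵀAH) = λ_n/λ_{k+1}`".
* §3 the deflated start (3.12) `x₀' = x₀ + V E⁻¹ Vᵀ (b − A x₀)`: `b − A x₀' = π_L (b − A x₀)`,
  `Vᵀ(b − A x₀') = 0`, and conversely `Vᵀ r₀ = 0 ⇒ x₀' = x₀`.
* §4 THE RATE in the tree's vocabulary (`IsCGIterate` = the Galerkin–Krylov iterate): if the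
  initial residual has no component along the eigenvectors whose eigenvalues lie outside
  `[α, β] ⊂ (0, ∞)`, then every CG iterate obeys Saad's (6.123)/(6.128) bounds with `κ' = β/α`
  (`IsCGIterate.aNormSq_le_chebyshev_of_residual`, `…_geometric_of_residual`,
  `aNorm_le_geometric_of_residual`, `aNorm_le_of_count_of_residual`); deflated directions never
  re-enter (`IsCGIterate.eigen_dotProduct_residual_eq_zero` — the Petrov–Galerkin condition (4.3)
  `r_j ⊥ W` holds along the whole iteration); and the packaged statements for CG started from the
  deflated start of an exact eigenvector deflation: `‖x_* − x_m‖_A ≤ 2((√κ'−1)/(√κ'+1))^m ‖x_* − x₀'‖_A`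
  with `κ' = β/α` for ANY `[α, β]` containing the NON-deflated eigenvalues, and the count
  `m ≥ ½√κ' ln(2/ε) ⇒ ‖x_* − x_m‖_A ≤ ε‖x_* − x₀'‖_A` (Theorem 4.3/4.6 with §5's `κ = λ_n/λ_{k+1}`).

* §5 (APPEND, same seat) CG ON THE SINGULAR DEFLATED SYSTEM `Aπ_R x̂ = π_L b` for a GENERAL
  deflation subspace: the Galerkin–Krylov iterate of a consistent positive SEMIdefinite system
  exists and is unique (`exists_isCGIterate_of_posSemidef`, `IsCGIterate.unique_of_posSemidef` —
  the Krylov space lies in `range M ⊥ ker M`), converges at the `√κ_eff` rate with `κ_eff` over the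
  NON-ZERO spectrum (`IsCGIterate.aNorm_le_geometric_of_posSemidef`, eq. (2.8)), and for
  `M = Aπ_R` with the reconstruction `x_m = π_R x̂_m + V E⁻¹ Vᵀ b` this is Kahl–Rittich's
  THEOREM 2 as an error bound: `‖x_* − x_m‖_A ≤ 2((√κ'−1)/(√κ'+1))^m ‖x_* − x_0‖_A` with
  `κ' = λ_max C/(1 − γ)` (`IsCGIterate.aNorm_le_geometric_of_deflatedSystem`).

HONEST SCOPE: exact arithmetic; real symmetric `A` (the lattice kernels `D†D` are complex
Hermitian — TODO(general form), as for the whole thread); nothing about how `V` is computed, the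
cost of the little solves, or finite-precision loss of `Vᵀ r_j = 0`; the three-term recursions
(Algorithm 3.5) are not formalised — as in the parent file every statement is about the Galerkin
iterate they compute.

## References
* [SaadEtAl2000] Y. Saad, M. Yeung, J. Erhel, F. Guyomarc'h, SIAM J. Sci. Comput. 21 (2000)
  1909–1926: §2 (2.3), §3 (3.2)–(3.3), (3.12), §4 (4.1), Prop. 4.1, Thm. 4.2, Thm. 4.3 (4.4),
  Thm. 4.6, §5 (p. 1917).
* [KahlRittich2017] K. Kahl, H. Rittich, Linear Algebra Appl. 515 (2017) 111–129, arXiv:1209.1963: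
  §2 (2.2)–(2.7), Lemma 1; §3.1 (3.1)–(3.3), Lemma 2; §3.2 Def. 1, Lemma 3, Thm. 1; §3.3
  (3.9)–(3.12), Lemma 4, Thm. 2; §4.1.
* [Saad2003] Y. Saad, *Iterative Methods for Sparse Linear Systems*, 2nd ed., SIAM (2003), §6.11.3
  Theorem 6.29 (through `ConjugateGradientConvergence.lean`).
-/

noncomputable section

open scoped Matrix
open Finset Polynomial

namespace Literature.Analysis.Matrix

namespace ConjugateGradient

open _root_.Matrix Literature.LinearAlgebra.Matrix.Deflation

variable {ι k : Type*} [Fintype ι] [Fintype k] [DecidableEq ι] [DecidableEq k]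

/-! ## §1 The deflated matrix `A π_R` of a real symmetric system -/

section Symmetric

variable {A : Matrix ι ι ℝ} {V : Matrix ι k ℝ}

omit [Fintype ι] [DecidableEq ι] [Fintype k] [DecidableEq k] in
/-- Over `ℝ` the conjugate transpose is the transpose. [folklore] -/
private theorem conjTranspose_real (M : Matrix ι k ℝ) : Mᴴ = Mᵀ :=
  conjTranspose_eq_transpose_of_trivial M

omit [DecidableEq ι] in
/-- The little operator with `Rs = Vᴴ` is the one with `Rs = Vᵀ` (real scalars). [folklore] -/
private theorem isUnit_littleOp_conjTranspose (hE : IsUnit (littleOp A V Vᵀ).det) :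
    IsUnit (littleOp A V Vᴴ).det := by
  rwa [conjTranspose_real]

/-- **`Hᵀ = I − AW(WᵀAW)⁻¹Wᵀ`**: for symmetric `A`, `π_Rᵀ = π_L`.
[cite: SaadEtAl2000, §4 (the pair `H`, `Hᵀ`); KahlRittich2017, §2 Lemma 1 (i)] -/
theorem transpose_piR (hA : A.IsHermitian) : (piR A V Vᵀ)ᵀ = piL A V Vᵀ := by
  have h := conjTranspose_piR_of_isHermitian (P := V) hA
  simpa only [conjTranspose_real] using h

/-- **`AH = HᵀAH`** (4.1): `A π_R = π_Rᵀ A π_R`. [cite: SaadEtAl2000, §4 eq. (4.1);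
KahlRittich2017, §2 Lemma 1 (i) eq. (2.6)] -/
theorem mul_piR_eq_transpose_mul_mul (hE : IsUnit (littleOp A V Vᵀ).det) (hA : A.IsHermitian) :
    A * piR A V Vᵀ = (piR A V Vᵀ)ᵀ * A * piR A V Vᵀ := by
  have h := mul_piR_eq_conjTranspose_mul_mul (isUnit_littleOp_conjTranspose hE) hA
  simpa only [conjTranspose_real] using h

/-- **`AH = HᵀA`** (4.1): `A π_R = π_L A`. [cite: SaadEtAl2000, §4 eq. (4.1)] -/
theorem mul_piR_eq_piL_mul : A * piR A V Vᵀ = piL A V Vᵀ * A := D_mul_piR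

/-- **The deflated matrix `B = A − AW(WᵀAW)⁻¹WᵀA = A π_R` is symmetric.**
[cite: SaadEtAl2000, §2 eq. (2.3) ("The matrix `B` is symmetric but not necessarily positive
definite"); KahlRittich2017, §2 Lemma 1 (ii)] -/
theorem isHermitian_mul_piR (hE : IsUnit (littleOp A V Vᵀ).det) (hA : A.IsHermitian) :
    (A * piR A V Vᵀ).IsHermitian := by
  have h := _root_.Literature.LinearAlgebra.Matrix.Deflation.isHermitian_mul_piR
    (isUnit_littleOp_conjTranspose hE) hA
  simpa only [conjTranspose_real] using h

/-- **The deflated matrix is positive semidefinite** for positive semidefinite `A`.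
[cite: KahlRittich2017, §2 Lemma 1 (ii)] -/
theorem posSemidef_mul_piR (hE : IsUnit (littleOp A V Vᵀ).det) (hA : A.PosSemidef) :
    (A * piR A V Vᵀ).PosSemidef := by
  have h := _root_.Literature.LinearAlgebra.Matrix.Deflation.posSemidef_mul_piR
    (isUnit_littleOp_conjTranspose hE) hA
  simpa only [conjTranspose_real] using h

/-- **`⟨A(I − π_A)x, x⟩ = ‖(I − π_A)x‖_A²`**: `xᵀ(Aπ_R)x = (π_R x)ᵀ A (π_R x)`.
[cite: KahlRittich2017, §2 Lemma 1 (proof of (ii))] -/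
theorem dotProduct_mul_piR_mulVec (hE : IsUnit (littleOp A V Vᵀ).det) (hA : A.IsHermitian)
    (x : ι → ℝ) :
    x ⬝ᵥ (A * piR A V Vᵀ) *ᵥ x = (piR A V Vᵀ *ᵥ x) ⬝ᵥ A *ᵥ (piR A V Vᵀ *ᵥ x) := by
  have h := star_dotProduct_mul_piR_mulVec (isUnit_littleOp_conjTranspose hE) hA x
  simpa only [conjTranspose_real, star_trivial] using h

omit [DecidableEq ι] [Fintype k] [DecidableEq k] in
/-- For real symmetric `A`: `(u, A w) = (w, A u)`. [folklore] -/
private theorem dotProduct_mulVec_comm' (hA : A.IsHermitian) (u w : ι → ℝ) :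
    u ⬝ᵥ A *ᵥ w = w ⬝ᵥ A *ᵥ u := by
  rw [dotProduct_mulVec, ← mulVec_transpose, KyFan.transpose_eq hA, dotProduct_comm]

omit [DecidableEq ι] [DecidableEq k] in
/-- `(M x, w) = (x, Mᵀ w)`. [folklore] -/
private theorem mulVec_dotProduct_eq (M : Matrix ι ι ℝ) (x w : ι → ℝ) :
    (M *ᵥ x) ⬝ᵥ w = x ⬝ᵥ Mᵀ *ᵥ w := by
  rw [dotProduct_mulVec, vecMul_transpose]

/-- The `A`-image of the coarse component: `A (x − π_R x) = (1 − π_L)(A x)`.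
[cite: KahlRittich2017, §2 eq. (2.2)–(2.3) (`x = (I − π_A)x + π_A x`, `π_A = V(V^*AV)⁻¹V^*A`)] -/
theorem mulVec_sub_piR_mulVec (x : ι → ℝ) :
    A *ᵥ (x - piR A V Vᵀ *ᵥ x) = (1 - piL A V Vᵀ) *ᵥ (A *ᵥ x) := by
  rw [mulVec_sub, mulVec_mulVec, mul_piR_eq_piL_mul, ← mulVec_mulVec, sub_mulVec, one_mulVec]

/-- **The splitting `x = π_R x + (1 − π_R)x` is `A`-orthogonal**: `(π_R x)ᵀ A (x − π_R x) = 0`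
(`I − π_R = π_A(𝒮)` is the `A`-orthogonal projection onto the deflation subspace).
[cite: KahlRittich2017, §2 eq. (2.2) ("via the `A`-orthogonal projection `π_A(𝒮)`");
SaadEtAl2000, §4 ("`H` … the `A`-orthogonal projection onto `W^{⊥_A}`")] -/
theorem piR_mulVec_dotProduct_mulVec_sub (hE : IsUnit (littleOp A V Vᵀ).det) (hA : A.IsHermitian)
    (x : ι → ℝ) :
    (piR A V Vᵀ *ᵥ x) ⬝ᵥ A *ᵥ (x - piR A V Vᵀ *ᵥ x) = 0 := by
  rw [mulVec_sub_piR_mulVec, mulVec_dotProduct_eq, transpose_piR hA, mulVec_mulVec, mul_sub,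
    mul_one, piL_mul_piL hE, sub_self, zero_mulVec, dotProduct_zero]

/-- **Pythagoras in the `A`-inner product**: `‖x‖_A² = ‖π_R x‖_A² + ‖(1 − π_R)x‖_A²`.
[cite: KahlRittich2017, §3.1 (proof of (3.1): `⟨A(I − π_A)x, x⟩ = ⟨Ax, x⟩ − ⟨Aπ_A x, x⟩`)] -/
theorem dotProduct_mulVec_eq_piR_add (hE : IsUnit (littleOp A V Vᵀ).det) (hA : A.IsHermitian)
    (x : ι → ℝ) :
    x ⬝ᵥ A *ᵥ x = (piR A V Vᵀ *ᵥ x) ⬝ᵥ A *ᵥ (piR A V Vᵀ *ᵥ x) +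
      (x - piR A V Vᵀ *ᵥ x) ⬝ᵥ A *ᵥ (x - piR A V Vᵀ *ᵥ x) := by
  set p := piR A V Vᵀ *ᵥ x with hp
  have hcross := piR_mulVec_dotProduct_mulVec_sub hE hA x
  rw [← hp] at hcross
  have hx : x = p + (x - p) := by abel
  conv_lhs => rw [hx]
  rw [mulVec_add, add_dotProduct, dotProduct_add, dotProduct_add, hcross,
    dotProduct_mulVec_comm' hA (x - p) p, hcross]
  ring

/-- **`⟨A(I − π_A)x, x⟩ ≤ ⟨Ax, x⟩`** (the step behind `μ₁ ≤ λ₁`): `‖π_R x‖_A² ≤ ‖x‖_A²` for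
positive semidefinite `A`. [cite: KahlRittich2017, §3.1 eq. (3.1)] -/
theorem piR_aNormSq_le (hE : IsUnit (littleOp A V Vᵀ).det) (hA : A.PosSemidef) (x : ι → ℝ) :
    (piR A V Vᵀ *ᵥ x) ⬝ᵥ A *ᵥ (piR A V Vᵀ *ᵥ x) ≤ x ⬝ᵥ A *ᵥ x := by
  rw [dotProduct_mulVec_eq_piR_add hE hA.1 x]
  have h := hA.dotProduct_mulVec_nonneg (x - piR A V Vᵀ *ᵥ x)
  rw [star_trivial] at h
  linarith

omit [DecidableEq ι] [Fintype k] [DecidableEq k] in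
/-- Rayleigh upper bound from a spectral bound: `λ_i ≤ β` for all `i` ⇒ `xᵀAx ≤ β xᵀx`.
[folklore] -/
private theorem dotProduct_mulVec_le_of_eigenvalues_le [DecidableEq ι] (hA : A.IsHermitian) {β : ℝ}
    (hspec : ∀ i, hA.eigenvalues i ≤ β) (x : ι → ℝ) : x ⬝ᵥ A *ᵥ x ≤ β * (x ⬝ᵥ x) := by
  rw [KyFan.dotProduct_mulVec_eq_sum_eigen hA x, KyFan.dotProduct_self_eq_sum_sq hA x, mul_sum]
  exact sum_le_sum fun i _ => mul_le_mul_of_nonneg_right (hspec i) (sq_nonneg _)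

omit [Fintype ι] [DecidableEq ι] [Fintype k] [DecidableEq k] in
/-- `x ≠ 0 ⇒ xᵀx > 0`. [folklore] -/
private theorem dotProduct_self_pos' [Fintype ι] {x : ι → ℝ} (hx : x ≠ 0) : 0 < x ⬝ᵥ x := by
  have h0 : 0 ≤ x ⬝ᵥ x := by
    unfold dotProduct; exact sum_nonneg fun i _ => mul_self_nonneg _
  rcases h0.lt_or_eq with h | h
  · exact h
  · exact absurd (dotProduct_self_eq_zero.mp h.symm) hx

/-- **`μ₁ ≤ λ₁ = ‖A‖`** (3.1): every eigenvalue `μ` of the deflated matrix `A π_R` is at most any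
upper bound `β` of the spectrum of the positive semidefinite `A`.
[cite: KahlRittich2017, §3.1 eq. (3.1)] -/
theorem eigenvalue_mul_piR_le (hE : IsUnit (littleOp A V Vᵀ).det) (hA : A.PosSemidef) {β : ℝ}
    (hspec : ∀ i, hA.1.eigenvalues i ≤ β) {μ : ℝ} {x : ι → ℝ} (hx : x ≠ 0)
    (hμ : (A * piR A V Vᵀ) *ᵥ x = μ • x) : μ ≤ β := by
  have hxx := dotProduct_self_pos' hx
  have h1 : x ⬝ᵥ (A * piR A V Vᵀ) *ᵥ x = μ * (x ⬝ᵥ x) := by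
    rw [hμ, dotProduct_smul, smul_eq_mul]
  have h2 := dotProduct_mul_piR_mulVec hE hA.1 x
  have h3 := piR_aNormSq_le hE hA x
  have h4 := dotProduct_mulVec_le_of_eigenvalues_le hA.1 hspec x
  exact le_of_mul_le_mul_right (by linarith) hxx

/-- **The deflated matrix has non-negative spectrum**: every eigenvalue `μ` of `A π_R` is `≥ 0`
for positive semidefinite `A`. [cite: KahlRittich2017, §2 Lemma 1 (ii) and the sentence
"`μ₁ ≥ ⋯ ≥ μ_n ≥ 0` be the eigenvalues of … `A(I − π_A(𝒮))`"] -/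
theorem eigenvalue_mul_piR_nonneg (hE : IsUnit (littleOp A V Vᵀ).det) (hA : A.PosSemidef)
    {μ : ℝ} {x : ι → ℝ} (hx : x ≠ 0) (hμ : (A * piR A V Vᵀ) *ᵥ x = μ • x) : 0 ≤ μ := by
  have hxx := dotProduct_self_pos' hx
  have h1 : x ⬝ᵥ (A * piR A V Vᵀ) *ᵥ x = μ * (x ⬝ᵥ x) := by
    rw [hμ, dotProduct_smul, smul_eq_mul]
  have h2 := dotProduct_mul_piR_mulVec hE hA.1 x
  have h3 := hA.dotProduct_mulVec_nonneg (piR A V Vᵀ *ᵥ x)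
  rw [star_trivial] at h3
  exact nonneg_of_mul_nonneg_left (by linarith) hxx

/-- **The kernel of the deflated matrix is the deflation subspace** ("the kernel of
`A(I − π_A(𝒮))` is the kernel of `(I − π_A(𝒮))` which is the deflation subspace `𝒮`"), for
positive definite `A`. [cite: KahlRittich2017, §3.1 (after Lemma 2)] -/
theorem mul_piR_mulVec_eq_zero_iff (hE : IsUnit (littleOp A V Vᵀ).det) (hA : A.PosDef)
    (x : ι → ℝ) : (A * piR A V Vᵀ) *ᵥ x = 0 ↔ ∃ y : k → ℝ, V *ᵥ y = x := by
  rw [← piR_mulVec_eq_zero_iff hE x, ← mulVec_mulVec]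
  have hAu : IsUnit A.det := hA.det_pos.ne'.isUnit
  constructor
  · intro h
    have := congrArg (A⁻¹.mulVec) h
    rwa [mulVec_mulVec, nonsing_inv_mul _ hAu, one_mulVec, mulVec_zero] at this
  · intro h
    rw [h, mulVec_zero]

omit [DecidableEq ι] [DecidableEq k] in
/-- `Vᵀ x` in coordinates: `(Vᵀ x) ⬝ y = x ⬝ (V y)`. [folklore] -/
private theorem transpose_mulVec_dotProduct (x : ι → ℝ) (y : k → ℝ) :
    (Vᵀ *ᵥ x) ⬝ᵥ y = x ⬝ᵥ V *ᵥ y := by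
  rw [mulVec_transpose, dotProduct_mulVec]

/-- **Eigenvectors of the deflated matrix with non-zero eigenvalue are orthogonal to the deflation
subspace**: `(Aπ_R)x = μx`, `μ ≠ 0 ⇒ Vᵀ x = 0` (they span `𝒮^⊥`, where Lemma 2 locates `μ_ℓ`).
[cite: KahlRittich2017, §3.1 (Lemma 2 and eq. (3.3): `μ_ℓ = min_{x ∈ 𝒮^⊥∖{0}} …`);
SaadEtAl2000, §2 ("`WᵀB = 0`")] -/
theorem transpose_mulVec_eq_zero_of_eigenvector (hE : IsUnit (littleOp A V Vᵀ).det) {μ : ℝ}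
    {x : ι → ℝ} (hμ0 : μ ≠ 0) (hμ : (A * piR A V Vᵀ) *ᵥ x = μ • x) : Vᵀ *ᵥ x = 0 := by
  have h : Vᵀ *ᵥ ((A * piR A V Vᵀ) *ᵥ x) = 0 := by
    rw [mulVec_mulVec, ← Matrix.mul_assoc, Rs_mul_D_mul_piR hE, zero_mulVec]
  rw [hμ, mulVec_smul] at h
  exact (smul_eq_zero.mp h).resolve_left hμ0

/-- **Kahl–Rittich's Theorems 1 and 2** (effective condition number from the weak approximation
property and the strengthened Cauchy–Schwarz inequality), in quadratic-form / `C`-form: let the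
deflation subspace `𝒮 = range V` satisfy the WEAK APPROXIMATION PROPERTY
`dist(𝒮, x)₂² ≤ C ‖x‖_A²` for all `x` (Lemma 3's form; `K = C‖A‖`) and let `γ ∈ [0, 1)` be a
strengthened Cauchy–Schwarz constant between `𝒮^⊥` and `𝒮` in the `A`-inner product,
`|uᵀAv| ≤ γ ‖u‖_A ‖v‖_A` for `u ⊥ 𝒮`, `v ∈ 𝒮`. Then every NON-ZERO eigenvalue `μ` of the deflated
matrix `A π_R` satisfies `μ ≥ (1 − γ)/C`; with `μ ≤ λ_max` (`eigenvalue_mul_piR_le`) this is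
`κ_eff ≤ λ_max C/(1 − γ) = K/(1 − γ)`. [cite: KahlRittich2017, §3.2 Definition 1, Lemma 3,
Theorem 1; §3.3 eqs. (3.9)–(3.12), Theorem 2] -/
theorem le_eigenvalue_mul_piR (hE : IsUnit (littleOp A V Vᵀ).det) (hA : A.PosSemidef) {C γ : ℝ}
    (hwap : ∀ x : ι → ℝ, ∃ y : k → ℝ, (x - V *ᵥ y) ⬝ᵥ (x - V *ᵥ y) ≤ C * (x ⬝ᵥ A *ᵥ x))
    (hγ0 : 0 ≤ γ) (hγ1 : γ < 1)
    (hcbs : ∀ u : ι → ℝ, Vᵀ *ᵥ u = 0 → ∀ y : k → ℝ,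
      |u ⬝ᵥ A *ᵥ (V *ᵥ y)| ≤
        γ * Real.sqrt (u ⬝ᵥ A *ᵥ u) * Real.sqrt ((V *ᵥ y) ⬝ᵥ A *ᵥ (V *ᵥ y)))
    {μ : ℝ} {x : ι → ℝ} (hx : x ≠ 0) (hμ0 : μ ≠ 0) (hμ : (A * piR A V Vᵀ) *ᵥ x = μ • x) :
    (1 - γ) / C ≤ μ := by
  have hxx := dotProduct_self_pos' hx
  -- `x ⊥ 𝒮`
  have hVx : Vᵀ *ᵥ x = 0 := transpose_mulVec_eq_zero_of_eigenvector hE hμ0 hμ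
  -- weak approximation at `x ⊥ 𝒮`: `‖x‖² ≤ dist(𝒮, x)² ≤ C ‖x‖_A²`
  obtain ⟨y, hy⟩ := hwap x
  have hxVy : x ⬝ᵥ V *ᵥ y = 0 := by rw [← transpose_mulVec_dotProduct, hVx, zero_dotProduct]
  have hdist : (x - V *ᵥ y) ⬝ᵥ (x - V *ᵥ y) = x ⬝ᵥ x + (V *ᵥ y) ⬝ᵥ (V *ᵥ y) := by
    rw [sub_dotProduct, dotProduct_sub, dotProduct_sub, hxVy, dotProduct_comm (V *ᵥ y) x, hxVy]
    ring
  have hVyVy : 0 ≤ (V *ᵥ y) ⬝ᵥ (V *ᵥ y) := by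
    unfold dotProduct; exact sum_nonneg fun i _ => mul_self_nonneg _
  have hwapx : x ⬝ᵥ x ≤ C * (x ⬝ᵥ A *ᵥ x) := by linarith
  have hxA : 0 ≤ x ⬝ᵥ A *ᵥ x := by
    have h := hA.dotProduct_mulVec_nonneg x; rwa [star_trivial] at h
  have hC : 0 < C := by
    by_contra hC
    have : C * (x ⬝ᵥ A *ᵥ x) ≤ 0 := mul_nonpos_of_nonpos_of_nonneg (not_lt.mp hC) hxA
    linarith
  -- the coarse component `v = π_R x − x = −V w ∈ 𝒮`
  set p := piR A V Vᵀ *ᵥ x with hp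
  set w : k → ℝ := -(((littleOp A V Vᵀ)⁻¹ * Vᵀ * A) *ᵥ x) with hw
  have hv : p - x = V *ᵥ w := by
    rw [hp, piR, sub_mulVec, one_mulVec, coarseCorrection, hw, mulVec_neg, mulVec_mulVec]
    simp only [Matrix.mul_assoc]
    abel
  -- strengthened Cauchy–Schwarz between `x ∈ 𝒮^⊥` and `p − x ∈ 𝒮`
  have hcs := hcbs x hVx w
  rw [← hv] at hcs
  set a := Real.sqrt (x ⬝ᵥ A *ᵥ x) with ha
  set c := Real.sqrt ((p - x) ⬝ᵥ A *ᵥ (p - x)) with hc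
  have hvA : 0 ≤ (p - x) ⬝ᵥ A *ᵥ (p - x) := by
    have h := hA.dotProduct_mulVec_nonneg (p - x); rwa [star_trivial] at h
  have ha2 : a ^ 2 = x ⬝ᵥ A *ᵥ x := Real.sq_sqrt hxA
  have hc2 : c ^ 2 = (p - x) ⬝ᵥ A *ᵥ (p - x) := Real.sq_sqrt hvA
  -- `‖p‖_A² = ‖x + (p − x)‖_A² = a² + 2 xᵀA(p − x) + c² ≥ (1 − γ)(a² + c²) ≥ (1 − γ) a²`
  have hexp : p ⬝ᵥ A *ᵥ p = x ⬝ᵥ A *ᵥ x + 2 * (x ⬝ᵥ A *ᵥ (p - x)) +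
      (p - x) ⬝ᵥ A *ᵥ (p - x) := by
    have : p = x + (p - x) := by abel
    conv_lhs => rw [this]
    rw [mulVec_add, add_dotProduct, dotProduct_add, dotProduct_add,
      dotProduct_mulVec_comm' hA.1 (p - x) x]
    ring
  have hcross : -(γ * (a ^ 2 + c ^ 2)) ≤ 2 * (x ⬝ᵥ A *ᵥ (p - x)) := by
    have h1 : -(γ * a * c) ≤ x ⬝ᵥ A *ᵥ (p - x) := by
      have := (abs_le.mp hcs).1; linarith
    have h2 : 2 * (a * c) ≤ a ^ 2 + c ^ 2 := by nlinarith [sq_nonneg (a - c)]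
    nlinarith
  have hpA : (1 - γ) * (x ⬝ᵥ A *ᵥ x) ≤ p ⬝ᵥ A *ᵥ p := by
    rw [hexp, ← ha2, ← hc2]
    nlinarith [sq_nonneg c]
  -- `μ ‖x‖² = xᵀ(Aπ_R)x = ‖p‖_A²`
  have hμx : μ * (x ⬝ᵥ x) = p ⬝ᵥ A *ᵥ p := by
    rw [hp, ← dotProduct_mul_piR_mulVec hE hA.1 x, hμ, dotProduct_smul, smul_eq_mul]
  -- assemble: `(1 − γ)/C · ‖x‖² ≤ (1 − γ) ‖x‖_A² ≤ ‖p‖_A² = μ ‖x‖²`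
  have hkey : (1 - γ) / C * (x ⬝ᵥ x) ≤ μ * (x ⬝ᵥ x) := by
    rw [hμx]
    calc (1 - γ) / C * (x ⬝ᵥ x) ≤ (1 - γ) / C * (C * (x ⬝ᵥ A *ᵥ x)) :=
          mul_le_mul_of_nonneg_left hwapx (div_nonneg (by linarith) hC.le)
      _ = (1 - γ) * (x ⬝ᵥ A *ᵥ x) := by field_simp
      _ ≤ p ⬝ᵥ A *ᵥ p := hpA
  exact le_of_mul_le_mul_right hkey hxx

omit [DecidableEq ι] [DecidableEq k] in
/-- **Lemma 4**: if the deflation subspace is `A`-invariant (`A V = V T` for some `T`), the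
strengthened Cauchy–Schwarz constant is `γ = 0`: `uᵀ A (V y) = 0` for every `u ⊥ 𝒮`.
[cite: KahlRittich2017, §3.3 Lemma 4] -/
theorem dotProduct_mulVec_range_eq_zero_of_invariant {T : Matrix k k ℝ} (hAV : A * V = V * T)
    {u : ι → ℝ} (hu : Vᵀ *ᵥ u = 0) (y : k → ℝ) : u ⬝ᵥ A *ᵥ (V *ᵥ y) = 0 := by
  rw [mulVec_mulVec, hAV, ← mulVec_mulVec, ← transpose_mulVec_dotProduct, hu, zero_dotProduct]

/-- **Theorem 2 with Lemma 4**: for an `A`-invariant deflation subspace with weak approximation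
constant `C`, every non-zero eigenvalue of `A π_R` is `≥ 1/C` (`ξ = 1`, `κ_eff ≤ K`).
[cite: KahlRittich2017, §3.3 Lemma 4 with Theorem 2] -/
theorem le_eigenvalue_mul_piR_of_invariant (hE : IsUnit (littleOp A V Vᵀ).det) (hA : A.PosSemidef)
    {C : ℝ} {T : Matrix k k ℝ} (hAV : A * V = V * T)
    (hwap : ∀ x : ι → ℝ, ∃ y : k → ℝ, (x - V *ᵥ y) ⬝ᵥ (x - V *ᵥ y) ≤ C * (x ⬝ᵥ A *ᵥ x))
    {μ : ℝ} {x : ι → ℝ} (hx : x ≠ 0) (hμ0 : μ ≠ 0) (hμ : (A * piR A V Vᵀ) *ᵥ x = μ • x) :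
    1 / C ≤ μ := by
  have h := le_eigenvalue_mul_piR hE hA hwap le_rfl zero_lt_one
    (fun u hu y => by
      rw [dotProduct_mulVec_range_eq_zero_of_invariant hAV hu y, abs_zero, zero_mul, zero_mul])
    hx hμ0 hμ
  rwa [sub_zero] at h

end Symmetric

/-! ## §2 Exact eigenvector deflation: `V = [q_{e(1)} | ⋯ | q_{e(k)}]` -/

section Eigen

variable {A : Matrix ι ι ℝ}

/-- **The matrix of deflated eigenvectors**: columns `q_{e j}`, `j : k`, taken from Mathlib's
orthonormal eigenbasis of the symmetric `A` ("the column vectors `w₁, …, w_k` of `W` are exact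
eigenvectors of `A`"). [cite: SaadEtAl2000, §5 (p. 1917)] -/
def eigMatrix (hA : A.IsHermitian) (e : k → ι) : Matrix ι k ℝ :=
  Matrix.of fun r j => (hA.eigenvectorBasis (e j)).ofLp r

omit [Fintype k] [DecidableEq k] in
/-- Coordinates: `(Vᵀ x)_j = q_{e j} ⬝ x`. [cite: SaadEtAl2000, §5 (p. 1917)] -/
theorem transpose_eigMatrix_mulVec (hA : A.IsHermitian) (e : k → ι) (x : ι → ℝ) (j : k) :
    ((eigMatrix hA e)ᵀ *ᵥ x) j = (hA.eigenvectorBasis (e j)).ofLp ⬝ᵥ x := rfl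

omit [DecidableEq k] in
/-- The `j`-th column of `V` is `q_{e j}`: `V (Pi.single j 1) = q_{e j}`.
[cite: SaadEtAl2000, §5 (p. 1917)] -/
theorem eigMatrix_mulVec_single [DecidableEq k] (hA : A.IsHermitian) (e : k → ι) (j : k) :
    eigMatrix hA e *ᵥ Pi.single j 1 = (hA.eigenvectorBasis (e j)).ofLp := by
  rw [mulVec_single_one]
  rfl

omit [DecidableEq k] in
/-- **The columns are eigenvectors**: `A V = V diag(λ_{e j})` — the deflation subspace is
`A`-invariant. [cite: SaadEtAl2000, §5 (p. 1917); KahlRittich2017, §4.1 ("Since the subspace `𝒮`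
is `A`-invariant")] -/
theorem mul_eigMatrix [DecidableEq k] (hA : A.IsHermitian) (e : k → ι) :
    A * eigMatrix hA e = eigMatrix hA e * diagonal fun j => hA.eigenvalues (e j) := by
  ext r j
  rw [mul_diagonal, mul_apply]
  have h := congrFun (hA.mulVec_eigenvectorBasis (e j)) r
  simp only [mulVec, dotProduct, Pi.smul_apply, smul_eq_mul] at h
  simpa only [eigMatrix, of_apply, mul_comm (hA.eigenvalues (e j))] using h

omit [Fintype k] in
/-- **Orthonormal columns**: `Vᵀ V = 1` for an injective selection `e`.
[cite: SaadEtAl2000, §5 (p. 1917) (eigenvectors of the symmetric `A`)] -/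
theorem transpose_eigMatrix_mul_eigMatrix (hA : A.IsHermitian) {e : k → ι}
    (he : Function.Injective e) : (eigMatrix hA e)ᵀ * eigMatrix hA e = 1 := by
  ext j j'
  rw [mul_apply, one_apply]
  have h := KyFan.eigenvectorBasis_dotProduct hA (e j) (e j')
  simp only [he.eq_iff] at h
  simpa only [transpose_apply, eigMatrix, of_apply, dotProduct] using h

/-- **The little operator of an exact eigenvector deflation is diagonal**:
`E = Vᵀ A V = diag(λ_{e j})`. [cite: SaadEtAl2000, §5 (p. 1917); KahlRittich2017, §4.1] -/
theorem littleOp_eigMatrix (hA : A.IsHermitian) {e : k → ι} (he : Function.Injective e) :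
    littleOp A (eigMatrix hA e) (eigMatrix hA e)ᵀ = diagonal fun j => hA.eigenvalues (e j) := by
  rw [littleOp, Matrix.mul_assoc, mul_eigMatrix, ← Matrix.mul_assoc,
    transpose_eigMatrix_mul_eigMatrix hA he, Matrix.one_mul]

/-- The little operator of an exact eigenvector deflation is invertible as soon as the deflated
eigenvalues are non-zero (e.g. `A` positive definite). [cite: SaadEtAl2000, §2 ("Since `A` is SPD,
the matrix `WᵀAW` is then nonsingular")] -/
theorem isUnit_littleOp_eigMatrix (hA : A.IsHermitian) {e : k → ι} (he : Function.Injective e)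
    (hne : ∀ j, hA.eigenvalues (e j) ≠ 0) :
    IsUnit (littleOp A (eigMatrix hA e) (eigMatrix hA e)ᵀ).det := by
  rw [littleOp_eigMatrix hA he, det_diagonal]
  exact (prod_ne_zero_iff.mpr fun j _ => hne j).isUnit

/-- **A deflated eigenvector is in the kernel of the deflated matrix**: `(Aπ_R) q_{e j} = 0`.
[cite: SaadEtAl2000, §5 (p. 1917) ("clearly `κ(HᵀAH) = λ_n/λ_{k+1}`"); KahlRittich2017, §4.1] -/
theorem mul_piR_mulVec_eigenvector_deflated (hA : A.IsHermitian) {e : k → ι}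
    (he : Function.Injective e) (hne : ∀ j, hA.eigenvalues (e j) ≠ 0) (j : k) :
    (A * piR A (eigMatrix hA e) (eigMatrix hA e)ᵀ) *ᵥ (hA.eigenvectorBasis (e j)).ofLp = 0 := by
  have h0 : piR A (eigMatrix hA e) (eigMatrix hA e)ᵀ *ᵥ (hA.eigenvectorBasis (e j)).ofLp = 0 :=
    (piR_mulVec_eq_zero_iff (isUnit_littleOp_eigMatrix hA he hne) _).mpr
      ⟨Pi.single j 1, eigMatrix_mulVec_single hA e j⟩
  rw [← mulVec_mulVec, h0, mulVec_zero]

/-- **A non-deflated eigenvector is an eigenvector of the deflated matrix with the SAME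
eigenvalue**: for `i ∉ range e`, `(Aπ_R) q_i = λ_i q_i`.  With the previous theorem: the spectrum
of `HᵀAH = Aπ_R` on the eigenbasis is `{0, …, 0} ∪ {λ_i : i not deflated}`, whence
"clearly `κ(HᵀAH) = λ_n/λ_{k+1}`" when the `k` smallest are deflated.
[cite: SaadEtAl2000, §5 (p. 1917); KahlRittich2017, §4.1] -/
theorem mul_piR_mulVec_eigenvector (hA : A.IsHermitian) (e : k → ι) {i : ι}
    (hi : i ∉ Set.range e) :
    (A * piR A (eigMatrix hA e) (eigMatrix hA e)ᵀ) *ᵥ (hA.eigenvectorBasis i).ofLp =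
      hA.eigenvalues i • (hA.eigenvectorBasis i).ofLp := by
  have horth : (eigMatrix hA e)ᵀ *ᵥ (hA.eigenvectorBasis i).ofLp = 0 := by
    ext j
    rw [transpose_eigMatrix_mulVec, KyFan.eigenvectorBasis_dotProduct hA, Pi.zero_apply, if_neg]
    rintro h
    exact hi ⟨j, h⟩
  have hfix : piR A (eigMatrix hA e) (eigMatrix hA e)ᵀ *ᵥ (hA.eigenvectorBasis i).ofLp =
      (hA.eigenvectorBasis i).ofLp := by
    refine piR_mulVec_of_Rs_D_mulVec_eq_zero ?_
    rw [hA.mulVec_eigenvectorBasis i, mulVec_smul, horth, smul_zero]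
  rw [← mulVec_mulVec, hfix, hA.mulVec_eigenvectorBasis i]

end Eigen

/-! ## §3 The deflated start `x₀' = x₀ + V E⁻¹ Vᵀ (b − A x₀)` -/

section Start

variable {A : Matrix ι ι ℝ} {V : Matrix ι k ℝ}

/-- **The deflated initial guess** (3.12): `x₀' = x₀ + W(WᵀAW)⁻¹Wᵀ r₀` with `r₀ = b − A x₀`
(Kahl–Rittich: the `𝒮`-component `π_A(𝒮)x = V(V^*AV)⁻¹V^*b` of the solution is computed exactly,
(2.3)). [cite: SaadEtAl2000, §3 eq. (3.12); KahlRittich2017, §2 eq. (2.3)] -/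
def deflatedStart (A : Matrix ι ι ℝ) (V : Matrix ι k ℝ) (x₀ b : ι → ℝ) : ι → ℝ :=
  x₀ + coarseCorrection A V Vᵀ *ᵥ (b - A *ᵥ x₀)

/-- **The residual of the deflated start is the `π_L`-projection of the old residual**:
`b − A x₀' = π_L (b − A x₀)`. [cite: SaadEtAl2000, §3 eq. (3.12) and §4 (`r_j = Hᵀ r_j`);
KahlRittich2017, §2 eq. (2.4) (right-hand side `(I − π_A)^* b`)] -/
theorem residual_deflatedStart (x₀ b : ι → ℝ) :
    b - A *ᵥ deflatedStart A V x₀ b = piL A V Vᵀ *ᵥ (b - A *ᵥ x₀) := by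
  rw [deflatedStart, mulVec_add, mulVec_mulVec, piL, sub_mulVec, one_mulVec]
  abel

/-- **`Wᵀ r₀ = 0` for the deflated start** ("To guarantee that the initial guess `x₀` satisfies
`Wᵀr₀ = 0`, we can choose `x₀` in the form (3.12)"). [cite: SaadEtAl2000, §3 eq. (3.12)] -/
theorem transpose_mulVec_residual_deflatedStart (hE : IsUnit (littleOp A V Vᵀ).det)
    (x₀ b : ι → ℝ) : Vᵀ *ᵥ (b - A *ᵥ deflatedStart A V x₀ b) = 0 := by
  rw [residual_deflatedStart]
  exact Rs_mulVec_piL_mulVec hE _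

omit [DecidableEq ι] in
/-- Conversely an initial guess whose residual is already orthogonal to `W` is its own deflated
start ("`x₀` with `Wᵀr₀ = 0` must have the form (3.12)"). [cite: SaadEtAl2000, §3 (after (3.12))] -/
theorem deflatedStart_eq_self_of_orthogonal {x₀ b : ι → ℝ} (h : Vᵀ *ᵥ (b - A *ᵥ x₀) = 0) :
    deflatedStart A V x₀ b = x₀ := by
  rw [deflatedStart, coarseCorrection, ← mulVec_mulVec, ← mulVec_mulVec, h, mulVec_zero,
    mulVec_zero, add_zero]

end Start

/-! ## §4 The rate: CG from a residual without components outside `[α, β]` -/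

section Rate

variable {A : Matrix ι ι ℝ}

/-- **`‖r(A) d‖_A² ≤ M² ‖d‖_A²` needs `|r(λ_i)| ≤ M` only on the eigen-directions PRESENT in `d`**
(`ξ_i = q_i ⬝ d ≠ 0`): the terms with `ξ_i = 0` drop out of `Σ λ_i r(λ_i)² ξ_i²`.
[cite: Saad2003, §6.11.3, proof of Theorem 6.29 (display `Σ λ_i r(λ_i)² ξ_i²`); SaadEtAl2000,
Theorem 4.3 (proof: "`r_j = P_j(HᵀAH) r₀` … the minimization property")] -/
theorem aNormSq_aeval_mulVec_le_of_coord (hA : A.IsHermitian) (hnn : ∀ i, 0 ≤ hA.eigenvalues i)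
    (r : ℝ[X]) {M : ℝ} (d : ι → ℝ)
    (hM : ∀ i, (hA.eigenvectorBasis i).ofLp ⬝ᵥ d ≠ 0 → |r.eval (hA.eigenvalues i)| ≤ M) :
    (aeval A r *ᵥ d) ⬝ᵥ A *ᵥ (aeval A r *ᵥ d) ≤ M ^ 2 * (d ⬝ᵥ A *ᵥ d) := by
  rw [aNormSq_aeval_mulVec_eq hA r d, KyFan.dotProduct_mulVec_eq_sum_eigen hA d, mul_sum]
  refine sum_le_sum fun i _ => ?_
  by_cases hξ : (hA.eigenvectorBasis i).ofLp ⬝ᵥ d = 0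
  · rw [hξ]; simp
  have h1 : (r.eval (hA.eigenvalues i)) ^ 2 ≤ M ^ 2 :=
    sq_le_sq' (abs_le.mp (hM i hξ)).1 (abs_le.mp (hM i hξ)).2
  have h2 : 0 ≤ hA.eigenvalues i * ((hA.eigenvectorBasis i).ofLp ⬝ᵥ d) ^ 2 :=
    mul_nonneg (hnn i) (sq_nonneg _)
  calc hA.eigenvalues i * ((r.eval (hA.eigenvalues i)) ^ 2 * ((hA.eigenvectorBasis i).ofLp ⬝ᵥ d) ^ 2)
      = (r.eval (hA.eigenvalues i)) ^ 2 *
          (hA.eigenvalues i * ((hA.eigenvectorBasis i).ofLp ⬝ᵥ d) ^ 2) := by ring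
    _ ≤ M ^ 2 * (hA.eigenvalues i * ((hA.eigenvectorBasis i).ofLp ⬝ᵥ d) ^ 2) :=
        mul_le_mul_of_nonneg_right h1 h2

/-- An eigen-direction is present in the initial error iff it is present in the initial residual:
`q_i ⬝ (b − A x₀) = λ_i (q_i ⬝ (x_* − x₀))`. [cite: SaadEtAl2000, §3 (3.2)–(3.3) (`r₀ ⊥ W`);
Saad2003, §6.11.3 (proof of Theorem 6.29: `r₀ = A d₀`)] -/
theorem eigen_dotProduct_residual_eq (hA : A.IsHermitian) {b x₀ xs : ι → ℝ} (hb : A *ᵥ xs = b)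
    (i : ι) :
    (hA.eigenvectorBasis i).ofLp ⬝ᵥ (b - A *ᵥ x₀) =
      hA.eigenvalues i * ((hA.eigenvectorBasis i).ofLp ⬝ᵥ (xs - x₀)) := by
  rw [← hb, ← mulVec_sub, ResidualBound.eigen_dotProduct_mulVec hA]

/-- **The key inequality of Theorem 6.29 / Theorem 4.3 for a deflated residual**: if every
eigen-direction present in `r₀ = b − A x₀` has its eigenvalue in a set `S`, and `r` is an admissible
residual polynomial (`deg r ≤ m`, `r(0) = 1`) with `|r| ≤ M` on `S`, then the `m`-th CG iterate
obeys `‖x_* − x_m‖_A² ≤ M² ‖x_* − x₀‖_A²`. [cite: SaadEtAl2000, Theorem 4.3 (proof); Saad2003,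
§6.11.3 Lemma 6.28 and proof of Theorem 6.29] -/
theorem IsCGIterate.aNormSq_le_of_residualPoly_bound_of_residual (hA : A.PosDef)
    {b x₀ xs x : ι → ℝ} {m : ℕ} (hx : IsCGIterate A b x₀ m x) (hb : A *ᵥ xs = b) {S : Set ℝ}
    (hspec : ∀ i, (hA.1.eigenvectorBasis i).ofLp ⬝ᵥ (b - A *ᵥ x₀) ≠ 0 → hA.1.eigenvalues i ∈ S)
    {r : ℝ[X]} (hrdeg : r.natDegree ≤ m) (hr0 : r.eval 0 = 1) {M : ℝ}
    (hM : ∀ t ∈ S, |r.eval t| ≤ M) :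
    (xs - x) ⬝ᵥ A *ᵥ (xs - x) ≤ M ^ 2 * ((xs - x₀) ⬝ᵥ A *ᵥ (xs - x₀)) := by
  refine (hx.aNormSq_le_residualPoly hA.posSemidef hb hrdeg hr0).trans
    (aNormSq_aeval_mulVec_le_of_coord hA.1 (fun i => (hA.eigenvalues_pos i).le) r (xs - x₀)
      fun i hξ => hM _ (hspec i ?_))
  rw [eigen_dotProduct_residual_eq hA.1 hb i]
  exact mul_ne_zero (hA.eigenvalues_pos i).ne' hξ

open Literature.Analysis.Approximation.ChebyshevShifted

/-- **Theorem 6.29, eq. (6.123), for a deflated residual**: if every eigen-direction present in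
`b − A x₀` has eigenvalue in `[α, β]`, `0 < α < β`, then
`‖x_* − x_m‖_A ≤ ‖x_* − x₀‖_A / T_m((β + α)/(β − α))` (squared).
[cite: SaadEtAl2000, Theorem 4.3 eq. (4.4) with §5 (p. 1917); Saad2003, §6.11.3 Theorem 6.29
eq. (6.123)] -/
theorem IsCGIterate.aNormSq_le_chebyshev_of_residual (hA : A.PosDef) {b x₀ xs x : ι → ℝ} {m : ℕ}
    (hx : IsCGIterate A b x₀ m x) (hb : A *ᵥ xs = b) {α β : ℝ} (hα : 0 < α) (hαβ : α < β)
    (hspec : ∀ i, (hA.1.eigenvectorBasis i).ofLp ⬝ᵥ (b - A *ᵥ x₀) ≠ 0 →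
      hA.1.eigenvalues i ∈ Set.Icc α β) :
    (xs - x) ⬝ᵥ A *ᵥ (xs - x) ≤
      (1 / (Chebyshev.T ℝ m).eval ((β + α) / (β - α))) ^ 2 * ((xs - x₀) ⬝ᵥ A *ᵥ (xs - x₀)) :=
  hx.aNormSq_le_of_residualPoly_bound_of_residual hA hb hspec (natDegree_shiftedChebyshev_le α β m)
    (eval_zero_shiftedChebyshev hα hαβ m) fun _ ht => abs_eval_shiftedChebyshev_le hα hαβ m ht

/-- **Theorem 4.3 / (6.128) for a deflated residual** (squared): spectrum SEEN BY THE RESIDUAL in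
`[α, β] ⊂ (0, ∞)`, `κ' = β/α` ⇒ `‖x_* − x_m‖_A² ≤ (2((√κ' − 1)/(√κ' + 1))^m)² ‖x_* − x₀‖_A²`.
[cite: SaadEtAl2000, Theorem 4.3 eq. (4.4); Saad2003, §6.11.3 Theorem 6.29 eq. (6.128)] -/
theorem IsCGIterate.aNormSq_le_geometric_of_residual (hA : A.PosDef) {b x₀ xs x : ι → ℝ}
    {m : ℕ} (hx : IsCGIterate A b x₀ m x) (hb : A *ᵥ xs = b) {α β : ℝ} (hα : 0 < α)
    (hαβ : α < β)
    (hspec : ∀ i, (hA.1.eigenvectorBasis i).ofLp ⬝ᵥ (b - A *ᵥ x₀) ≠ 0 →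
      hA.1.eigenvalues i ∈ Set.Icc α β) :
    (xs - x) ⬝ᵥ A *ᵥ (xs - x) ≤
      (2 * ((Real.sqrt (β / α) - 1) / (Real.sqrt (β / α) + 1)) ^ m) ^ 2 *
        ((xs - x₀) ⬝ᵥ A *ᵥ (xs - x₀)) :=
  hx.aNormSq_le_of_residualPoly_bound_of_residual hA hb hspec (natDegree_shiftedChebyshev_le α β m)
    (eval_zero_shiftedChebyshev hα hαβ m)
    fun _ ht => abs_eval_shiftedChebyshev_le_geometric hα hαβ m ht

/-- **Theorem 4.3 eq. (4.4) for a deflated residual**, in `A`-norms: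
`‖x_* − x_m‖_A ≤ 2((√κ' − 1)/(√κ' + 1))^m ‖x_* − x₀‖_A` with `κ' = β/α` for any
`[α, β] ⊂ (0, ∞)` containing the eigenvalues seen by the initial residual.
[cite: SaadEtAl2000, Theorem 4.3 eq. (4.4); Saad2003, §6.11.3 Theorem 6.29 eq. (6.128)] -/
theorem IsCGIterate.aNorm_le_geometric_of_residual (hA : A.PosDef) {b x₀ xs x : ι → ℝ}
    {m : ℕ} (hx : IsCGIterate A b x₀ m x) (hb : A *ᵥ xs = b) {α β : ℝ} (hα : 0 < α)
    (hαβ : α < β)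
    (hspec : ∀ i, (hA.1.eigenvectorBasis i).ofLp ⬝ᵥ (b - A *ᵥ x₀) ≠ 0 →
      hA.1.eigenvalues i ∈ Set.Icc α β) :
    aNorm A (xs - x) ≤
      2 * ((Real.sqrt (β / α) - 1) / (Real.sqrt (β / α) + 1)) ^ m * aNorm A (xs - x₀) := by
  have hρ : 0 ≤ 2 * ((Real.sqrt (β / α) - 1) / (Real.sqrt (β / α) + 1)) ^ m := by
    have hκ : 1 ≤ Real.sqrt (β / α) := by
      rw [show (1 : ℝ) = Real.sqrt 1 by simp]
      exact Real.sqrt_le_sqrt (((one_lt_div hα).mpr hαβ).le)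
    have : 0 ≤ (Real.sqrt (β / α) - 1) / (Real.sqrt (β / α) + 1) :=
      div_nonneg (by linarith) (by linarith)
    positivity
  have h := hx.aNormSq_le_geometric_of_residual hA hb hα hαβ hspec
  rw [← aNorm_sq hA.posSemidef, ← aNorm_sq hA.posSemidef, ← mul_pow] at h
  have hrhs : 0 ≤ 2 * ((Real.sqrt (β / α) - 1) / (Real.sqrt (β / α) + 1)) ^ m * aNorm A (xs - x₀) :=
    mul_nonneg hρ (aNorm_nonneg A _)
  exact (pow_le_pow_iff_left₀ (aNorm_nonneg A _) hrhs two_ne_zero).mp h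

/-- **The deflated iteration count**: spectrum seen by the residual in `[α, β] ⊂ (0, ∞)`,
`κ' = β/α`, `0 < ε` and `m ≥ ½ √κ' ln(2/ε)` ⇒ `‖x_* − x_m‖_A ≤ ε ‖x_* − x₀‖_A` (Theorem 4.3 with
Axelsson's count, through `ConjugateGradientConvergence.lean`). [cite: SaadEtAl2000, Theorem 4.3
eq. (4.4) and Theorem 4.6 ("the convergence rate is governed by the condition number `κ` of
`HᵀAH`"); Saad2003, §6.11.3 Theorem 6.29] -/
theorem IsCGIterate.aNorm_le_of_count_of_residual (hA : A.PosDef) {b x₀ xs x : ι → ℝ}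
    {m : ℕ} (hx : IsCGIterate A b x₀ m x) (hb : A *ᵥ xs = b) {α β ε : ℝ} (hα : 0 < α)
    (hαβ : α < β) (hε : 0 < ε)
    (hspec : ∀ i, (hA.1.eigenvectorBasis i).ofLp ⬝ᵥ (b - A *ᵥ x₀) ≠ 0 →
      hA.1.eigenvalues i ∈ Set.Icc α β)
    (hm : Real.sqrt (β / α) / 2 * Real.log (2 / ε) ≤ m) :
    aNorm A (xs - x) ≤ ε * aNorm A (xs - x₀) := by
  have hκ : 1 < β / α := (one_lt_div hα).mpr hαβ
  have hrate := two_mul_pow_le_of_sqrt_mul_log_le hκ hε hm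
  exact (hx.aNorm_le_geometric_of_residual hA hb hα hαβ hspec).trans
    (mul_le_mul_of_nonneg_right hrate (aNorm_nonneg A _))

/-- **Deflated directions never re-enter** (the Petrov–Galerkin condition (4.3) `r_j ⊥ W` holds
along the plain CG iteration once `r₀ ⊥ W`, for eigenvector deflation): if `q_i ⬝ r₀ = 0` then
`q_i ⬝ (b − A x_m) = 0` for every Galerkin–Krylov iterate `x_m`.
[cite: SaadEtAl2000, §3 (3.2)–(3.3) and Proposition 4.1 eq. (4.3); §2 ("`v_{j+1}ᵀ W = 0` for
`j = 1, 2, …`")] -/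
theorem IsCGIterate.eigen_dotProduct_residual_eq_zero (hA : A.IsHermitian) {b x₀ x : ι → ℝ}
    {m : ℕ} (hx : IsCGIterate A b x₀ m x) {i : ι}
    (hi : (hA.eigenvectorBasis i).ofLp ⬝ᵥ (b - A *ᵥ x₀) = 0) :
    (hA.eigenvectorBasis i).ofLp ⬝ᵥ (b - A *ᵥ x) = 0 := by
  obtain ⟨p, -, hp⟩ := mem_krylov_iff.mp hx.mem_krylov
  have hres : b - A *ᵥ x = (b - A *ᵥ x₀) - A *ᵥ (x - x₀) := by rw [mulVec_sub]; abel
  rw [hres, dotProduct_sub, hi, ResidualBound.eigen_dotProduct_mulVec hA, ← hp,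
    ChebyshevIteration.eigen_dotProduct_aeval_mulVec hA, hi, mul_zero, mul_zero, sub_zero]

omit [Fintype k] [DecidableEq k] in
/-- **`Wᵀ r_m = 0` along the iteration** for an exact eigenvector deflation started with
`Wᵀ r₀ = 0`. [cite: SaadEtAl2000, Proposition 4.1 eq. (4.3)] -/
theorem IsCGIterate.transpose_eigMatrix_mulVec_residual_eq_zero (hA : A.IsHermitian) {e : k → ι}
    {b x₀ x : ι → ℝ} {m : ℕ} (hx : IsCGIterate A b x₀ m x)
    (h0 : (eigMatrix hA e)ᵀ *ᵥ (b - A *ᵥ x₀) = 0) :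
    (eigMatrix hA e)ᵀ *ᵥ (b - A *ᵥ x) = 0 := by
  ext j
  rw [transpose_eigMatrix_mulVec, Pi.zero_apply]
  refine hx.eigen_dotProduct_residual_eq_zero hA ?_
  have := congrFun h0 j
  rwa [transpose_eigMatrix_mulVec] at this

/-- **Deflated CG with exact eigenvectors, the rate** (Theorem 4.3 with §5's
`κ(HᵀAH) = λ_n/λ_{k+1}`, in the tree's vocabulary): let `A` be symmetric positive definite,
`V = [q_{e j}]` an injective selection of its orthonormal eigenvectors, and `x₀'` the deflated
start (3.12) from any `x₀`.  If `[α, β] ⊂ (0, ∞)` contains the eigenvalue of every NON-deflated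
eigenvector, then every CG iterate `x_m` from `x₀'` satisfies
`‖x_* − x_m‖_A ≤ 2((√κ' − 1)/(√κ' + 1))^m ‖x_* − x₀'‖_A`, `κ' = β/α` — the deflated eigenvalues
no longer enter the condition number. [cite: SaadEtAl2000, §3 eq. (3.12), Theorem 4.3 eq. (4.4),
§5 (p. 1917); KahlRittich2017, §4.1] -/
theorem IsCGIterate.aNorm_le_geometric_of_eigDeflation (hA : A.PosDef) {e : k → ι}
    (he : Function.Injective e) {b x₀ xs x : ι → ℝ} {m : ℕ}
    (hx : IsCGIterate A b (deflatedStart A (eigMatrix hA.1 e) x₀ b) m x) (hb : A *ᵥ xs = b)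
    {α β : ℝ} (hα : 0 < α) (hαβ : α < β)
    (hspec : ∀ i, i ∉ Set.range e → hA.1.eigenvalues i ∈ Set.Icc α β) :
    aNorm A (xs - x) ≤
      2 * ((Real.sqrt (β / α) - 1) / (Real.sqrt (β / α) + 1)) ^ m *
        aNorm A (xs - deflatedStart A (eigMatrix hA.1 e) x₀ b) := by
  have hE := isUnit_littleOp_eigMatrix hA.1 he fun j => (hA.eigenvalues_pos (e j)).ne'
  have h0 := transpose_mulVec_residual_deflatedStart hE x₀ b
  refine hx.aNorm_le_geometric_of_residual hA hb hα hαβ fun i hi => hspec i ?_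
  rintro ⟨j, rfl⟩
  exact hi (by simpa only [transpose_eigMatrix_mulVec, Pi.zero_apply] using congrFun h0 j)

/-- **Deflated CG with exact eigenvectors, the iteration count**: with `κ' = β/α` for any
`[α, β] ⊂ (0, ∞)` containing the non-deflated eigenvalues, `m ≥ ½ √κ' ln(2/ε)` CG steps from the
deflated start give `‖x_* − x_m‖_A ≤ ε ‖x_* − x₀'‖_A` — deflating the eigenvalues below `α`
replaces `√(λ_max/λ_min)` by `√(λ_max/α)` in the count.
[cite: SaadEtAl2000, Theorem 4.3 eq. (4.4), Theorem 4.6, §5 (p. 1917); KahlRittich2017, §4.1] -/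
theorem IsCGIterate.aNorm_le_of_count_of_eigDeflation (hA : A.PosDef) {e : k → ι}
    (he : Function.Injective e) {b x₀ xs x : ι → ℝ} {m : ℕ}
    (hx : IsCGIterate A b (deflatedStart A (eigMatrix hA.1 e) x₀ b) m x) (hb : A *ᵥ xs = b)
    {α β ε : ℝ} (hα : 0 < α) (hαβ : α < β) (hε : 0 < ε)
    (hspec : ∀ i, i ∉ Set.range e → hA.1.eigenvalues i ∈ Set.Icc α β)
    (hm : Real.sqrt (β / α) / 2 * Real.log (2 / ε) ≤ m) :
    aNorm A (xs - x) ≤ ε * aNorm A (xs - deflatedStart A (eigMatrix hA.1 e) x₀ b) := by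
  have hE := isUnit_littleOp_eigMatrix hA.1 he fun j => (hA.eigenvalues_pos (e j)).ne'
  have h0 := transpose_mulVec_residual_deflatedStart hE x₀ b
  refine hx.aNorm_le_of_count_of_residual hA hb hα hαβ hε (fun i hi => hspec i ?_) hm
  rintro ⟨j, rfl⟩
  exact hi (by simpa only [transpose_eigMatrix_mulVec, Pi.zero_apply] using congrFun h0 j)

/-- **The Petrov–Galerkin conditions (4.3) of Deflated-CG hold for plain CG from the deflated
start**: `Wᵀ r₀' = 0` and `Wᵀ r_m = 0` for all `m` (exact eigenvector deflation) — together with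
`r_m ⊥ 𝒦_m` (`IsCGIterate.galerkin`) these are Saad et al.'s conditions `r₀ ⊥ W`,
`r_j ⊥ 𝒦_{k,j}(A, W, r₀)`, so no `W`-directions need to be carried in the iteration.
[cite: SaadEtAl2000, Proposition 4.1 eqs. (4.2)–(4.3) with §3 eq. (3.12)] -/
theorem IsCGIterate.petrovGalerkin_of_eigDeflation (hA : A.PosDef) {e : k → ι}
    (he : Function.Injective e) {b x₀ x : ι → ℝ} {m : ℕ}
    (hx : IsCGIterate A b (deflatedStart A (eigMatrix hA.1 e) x₀ b) m x) :
    (eigMatrix hA.1 e)ᵀ *ᵥ (b - A *ᵥ deflatedStart A (eigMatrix hA.1 e) x₀ b) = 0 ∧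
      (eigMatrix hA.1 e)ᵀ *ᵥ (b - A *ᵥ x) = 0 := by
  have hE := isUnit_littleOp_eigMatrix hA.1 he fun j => (hA.eigenvalues_pos (e j)).ne'
  have h0 := transpose_mulVec_residual_deflatedStart hE x₀ b
  exact ⟨h0, hx.transpose_eigMatrix_mulVec_residual_eq_zero hA.1 h0⟩

end Rate

/-! ## §5 CG on the singular deflated system `Aπ_R x̂ = π_L b` (general deflation subspace): the
`√κ_eff` rate with `κ_eff` over the NON-ZERO spectrum, hence `κ_eff ≤ λ_max C/(1 − γ)`

APPEND (gen 37, same seat).  Kahl–Rittich, §2 (chunk p0006): "we think of deflated CG as applying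
the standard CG algorithm to the deflated system (2.4) with the matrix `A(I − π_A(𝒮))` … The lack of
regularity is no impediment to the standard CG iteration as long as (2.4) is consistent … Let
`μ₁ ≥ ⋯ ≥ μ_n ≥ 0` be the eigenvalues of … `A(I − π_A(𝒮))`. Let `ℓ` denote the largest index such
that `μ_ℓ ≠ 0`. The errors of the CG iterates then satisfy
`‖e_i‖_A ≤ 2((√κ_eff − 1)/(√κ_eff + 1))^i ‖e₀‖_A` … where `κ_eff = μ₁/μ_ℓ`" (2.8); Saad et al.
Theorem 4.6: "Deflated-CG is equivalent to CG … applied to the linear system `HᵀAH x̃ = Hᵀb`.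
Therefore, the convergence rate is governed by the condition number `κ` of `HᵀAH` and given by
(4.4)", with `x_j = H x̃_j + W y₀` (p. 1917).  The Galerkin–Krylov iterate of a CONSISTENT positive
SEMIdefinite system exists and is unique (the Krylov space lies in `range M ⊥ ker M`), and the
residual-polynomial argument of Theorem 6.29 goes through verbatim because the kernel directions
carry the weight `μ_i = 0` in `‖r(M)d‖_M² = Σ μ_i r(μ_i)² ξ_i²`. -/

section Singular

open Literature.Analysis.Approximation.ChebyshevShifted

variable {M : Matrix ι ι ℝ}

omit [Fintype k] [DecidableEq k] in
/-- The Krylov space of a consistent system lies in the range: every element of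
`𝒦_m(M, M d)` is `M y` for some `y`. [cite: KahlRittich2017, §2 Lemma 1 (iii) (consistency:
"the right hand side … is in the range of `A(I − π_A(𝒮))`")] -/
theorem exists_mulVec_eq_of_mem_krylov {d y : ι → ℝ} {m : ℕ} (hy : y ∈ krylov M (M *ᵥ d) m) :
    ∃ z, M *ᵥ z = y := by
  obtain ⟨p, -, rfl⟩ := mem_krylov_iff.mp hy
  refine ⟨aeval M p *ᵥ d, ?_⟩
  rw [mulVec_mulVec, mulVec_mulVec]
  congr 1
  have h : aeval M (p * X) = aeval M (X * p) := by rw [mul_comm]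
  rw [map_mul, map_mul, aeval_X] at h
  exact h.symm

omit [Fintype k] [DecidableEq k] in
/-- For symmetric positive semidefinite `M`: a vector in the range with vanishing `M`-form is zero
(`range M ∩ ker M = 0`). [cite: KahlRittich2017, §3.1 ("Since the matrix `A` has full rank, the
kernel of `A(I − π_A(𝒮))` is the kernel of `(I − π_A(𝒮))`", with Lemma 2)] -/
theorem eq_zero_of_range_of_form_eq_zero (hM : M.PosSemidef) {u z : ι → ℝ} (hz : M *ᵥ z = u)
    (hu : u ⬝ᵥ M *ᵥ u = 0) : u = 0 := by
  -- `uᵀMu = Σ λ_i ξ_i² = 0` with `λ_i ≥ 0` forces `λ_i ξ_i = 0` for every `i`, i.e. `M u = 0`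
  have hterms : ∀ i, hM.1.eigenvalues i * ((hM.1.eigenvectorBasis i).ofLp ⬝ᵥ u) ^ 2 = 0 := by
    have hs : ∑ i, hM.1.eigenvalues i * ((hM.1.eigenvectorBasis i).ofLp ⬝ᵥ u) ^ 2 = 0 := by
      rw [← KyFan.dotProduct_mulVec_eq_sum_eigen hM.1 u]; exact hu
    have hnn : ∀ i ∈ (Finset.univ : Finset ι),
        0 ≤ hM.1.eigenvalues i * ((hM.1.eigenvectorBasis i).ofLp ⬝ᵥ u) ^ 2 :=
      fun i _ => mul_nonneg (hM.eigenvalues_nonneg i) (sq_nonneg _)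
    exact fun i => (sum_eq_zero_iff_of_nonneg hnn).mp hs i (mem_univ i)
  have hMu : M *ᵥ u = 0 := by
    rw [KyFan.eq_sum_dotProduct_smul hM.1 (M *ᵥ u)]
    refine sum_eq_zero fun i _ => ?_
    rw [ResidualBound.eigen_dotProduct_mulVec hM.1 u i]
    rcases mul_eq_zero.mp (hterms i) with h | h
    · rw [h, zero_mul, zero_smul]
    · rw [pow_eq_zero_iff two_ne_zero] at h
      rw [h, mul_zero, zero_smul]
  have huu : u ⬝ᵥ u = 0 := by
    have h1 : u ⬝ᵥ u = (M *ᵥ z) ⬝ᵥ u := by rw [hz]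
    rw [h1, mulVec_dotProduct_eq, KyFan.transpose_eq hM.1, hMu, dotProduct_zero]
  exact dotProduct_self_eq_zero.mp huu

omit [Fintype k] [DecidableEq k] in
/-- **Existence of the Galerkin–Krylov (CG) iterate for a CONSISTENT positive semidefinite
system** ("The lack of regularity is no impediment to the standard CG iteration as long as (2.4) is
consistent"): if `M ⪰ 0` is symmetric and `b = M x_*`, the Galerkin iterate on `x₀ + 𝒦_m(M, r₀)`
exists for every `x₀`, `m`. [cite: KahlRittich2017, §2 (after Lemma 1, citing Kaasschieter 1988);
Saad2003, Proposition 5.1 (i)] -/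
theorem exists_isCGIterate_of_posSemidef (hM : M.PosSemidef) {b xs : ι → ℝ} (hb : M *ᵥ xs = b)
    (x₀ : ι → ℝ) (m : ℕ) : ∃ x, IsCGIterate M b x₀ m x := by
  classical
  have hr0 : b - M *ᵥ x₀ = M *ᵥ (xs - x₀) := by rw [mulVec_sub, hb]
  set K := krylov M (b - M *ᵥ x₀) m with hK
  set B : LinearMap.BilinForm ℝ (ι → ℝ) := Matrix.toBilin' M with hB
  have hBapp : ∀ u w : ι → ℝ, B u w = u ⬝ᵥ M *ᵥ w := fun u w => Matrix.toBilin'_apply' M u w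
  have hrefl : B.IsRefl := by
    intro u w h
    rw [hBapp] at h ⊢
    rwa [dotProduct_mulVec_comm' hM.1]
  have hsep : ∀ u : K, B u u = 0 → u = 0 := by
    intro u hu
    have huK : (u : ι → ℝ) ∈ krylov M (M *ᵥ (xs - x₀)) m := by rw [← hr0]; exact u.2
    obtain ⟨z, hz⟩ := exists_mulVec_eq_of_mem_krylov huK
    rw [hBapp] at hu
    exact Subtype.ext (eq_zero_of_range_of_form_eq_zero hM hz hu)
  have hnd : (B.restrict K).Nondegenerate := by
    refine ⟨fun u hu => hsep u ?_, fun u hu => hsep u ?_⟩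
    · simpa using hu u
    · simpa using hu u
  have hcompl := LinearMap.BilinForm.isCompl_orthogonal_of_restrict_nondegenerate hrefl hnd
  obtain ⟨δ, z, hδ, hz, hsum⟩ :=
    Submodule.codisjoint_iff_exists_add_eq.mp hcompl.codisjoint (xs - x₀)
  refine ⟨x₀ + δ, ⟨by simpa using hδ, fun w hw => ?_⟩⟩
  have hres : b - M *ᵥ (x₀ + δ) = M *ᵥ z := by
    have : b - M *ᵥ x₀ = M *ᵥ δ + M *ᵥ z := by rw [← mulVec_add, hsum, hr0]
    rw [mulVec_add, ← sub_sub, this]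
    abel
  rw [hres, ← hBapp]
  exact LinearMap.BilinForm.mem_orthogonal_iff.mp hz w hw

omit [Fintype k] [DecidableEq k] in
/-- **Uniqueness** of the Galerkin–Krylov iterate of a consistent positive semidefinite system.
[cite: KahlRittich2017, §2 (after Lemma 1); Saad2003, Proposition 5.1 (i)] -/
theorem IsCGIterate.unique_of_posSemidef (hM : M.PosSemidef) {b xs x₀ x x' : ι → ℝ} {m : ℕ}
    (hb : M *ᵥ xs = b) (hx : IsCGIterate M b x₀ m x) (hx' : IsCGIterate M b x₀ m x') :
    x = x' := by
  have hr0 : b - M *ᵥ x₀ = M *ᵥ (xs - x₀) := by rw [mulVec_sub, hb]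
  have hK : x - x' ∈ krylov M (b - M *ᵥ x₀) m := by
    have h := Submodule.sub_mem _ hx.mem_krylov hx'.mem_krylov
    rwa [sub_sub_sub_cancel_right] at h
  have hzero : (x - x') ⬝ᵥ M *ᵥ (x - x') = 0 := by
    have h1 := hx.galerkin _ hK
    have h2 := hx'.galerkin _ hK
    have : M *ᵥ (x - x') = (b - M *ᵥ x') - (b - M *ᵥ x) := by rw [mulVec_sub]; abel
    rw [this, dotProduct_sub, h1, h2, sub_zero]
  rw [hr0] at hK
  obtain ⟨z, hz⟩ := exists_mulVec_eq_of_mem_krylov hK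
  exact sub_eq_zero.mp (eq_zero_of_range_of_form_eq_zero hM hz hzero)

omit [Fintype k] [DecidableEq k] in
/-- **`‖r(M) d‖_M² ≤ max_{μ_i ≠ 0} r(μ_i)² · ‖d‖_M²`**: the kernel directions carry the weight
`μ_i = 0` and drop out, so only the NON-ZERO eigenvalues (seen by `d`) need the bound `|r| ≤ M`.
[cite: KahlRittich2017, §2 eq. (2.8) (`κ_eff = μ₁/μ_ℓ`, `μ_ℓ` the smallest non-zero
eigenvalue); Saad2003, §6.11.3, proof of Theorem 6.29] -/
theorem aNormSq_aeval_mulVec_le_of_active (hM : M.IsHermitian) (hnn : ∀ i, 0 ≤ hM.eigenvalues i)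
    (r : ℝ[X]) {C : ℝ} (d : ι → ℝ)
    (hC : ∀ i, hM.eigenvalues i ≠ 0 → (hM.eigenvectorBasis i).ofLp ⬝ᵥ d ≠ 0 →
      |r.eval (hM.eigenvalues i)| ≤ C) :
    (aeval M r *ᵥ d) ⬝ᵥ M *ᵥ (aeval M r *ᵥ d) ≤ C ^ 2 * (d ⬝ᵥ M *ᵥ d) := by
  rw [aNormSq_aeval_mulVec_eq hM r d, KyFan.dotProduct_mulVec_eq_sum_eigen hM d, mul_sum]
  refine sum_le_sum fun i _ => ?_
  by_cases hμ : hM.eigenvalues i = 0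
  · rw [hμ]; simp
  by_cases hξ : (hM.eigenvectorBasis i).ofLp ⬝ᵥ d = 0
  · rw [hξ]; simp
  have h1 : (r.eval (hM.eigenvalues i)) ^ 2 ≤ C ^ 2 :=
    sq_le_sq' (abs_le.mp (hC i hμ hξ)).1 (abs_le.mp (hC i hμ hξ)).2
  have h2 : 0 ≤ hM.eigenvalues i * ((hM.eigenvectorBasis i).ofLp ⬝ᵥ d) ^ 2 :=
    mul_nonneg (hnn i) (sq_nonneg _)
  calc hM.eigenvalues i * ((r.eval (hM.eigenvalues i)) ^ 2 * ((hM.eigenvectorBasis i).ofLp ⬝ᵥ d) ^ 2)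
      = (r.eval (hM.eigenvalues i)) ^ 2 *
          (hM.eigenvalues i * ((hM.eigenvectorBasis i).ofLp ⬝ᵥ d) ^ 2) := by ring
    _ ≤ C ^ 2 * (hM.eigenvalues i * ((hM.eigenvectorBasis i).ofLp ⬝ᵥ d) ^ 2) :=
        mul_le_mul_of_nonneg_right h1 h2

omit [Fintype k] [DecidableEq k] in
/-- **The `√κ_eff` rate for a consistent positive semidefinite system** (squared, `M`-seminorm):
if `[α, β] ⊂ (0, ∞)` contains every NON-ZERO eigenvalue of `M ⪰ 0` and `b = M x_*`, then every
Galerkin–Krylov iterate obeys `‖x_* − x_m‖_M² ≤ (2((√κ'−1)/(√κ'+1))^m)² ‖x_* − x₀‖_M²`, `κ' = β/α`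
("`κ_eff = μ₁/μ_ℓ`", eq. (2.8)). [cite: KahlRittich2017, §2 eq. (2.8); SaadEtAl2000, Theorem 4.3
eq. (4.4)] -/
theorem IsCGIterate.aNormSq_le_geometric_of_posSemidef (hM : M.PosSemidef) {b x₀ xs x : ι → ℝ}
    {m : ℕ} (hx : IsCGIterate M b x₀ m x) (hb : M *ᵥ xs = b) {α β : ℝ} (hα : 0 < α)
    (hαβ : α < β) (hspec : ∀ i, hM.1.eigenvalues i ≠ 0 → hM.1.eigenvalues i ∈ Set.Icc α β) :
    (xs - x) ⬝ᵥ M *ᵥ (xs - x) ≤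
      (2 * ((Real.sqrt (β / α) - 1) / (Real.sqrt (β / α) + 1)) ^ m) ^ 2 *
        ((xs - x₀) ⬝ᵥ M *ᵥ (xs - x₀)) :=
  (hx.aNormSq_le_residualPoly hM hb (natDegree_shiftedChebyshev_le α β m)
    (eval_zero_shiftedChebyshev hα hαβ m)).trans
    (aNormSq_aeval_mulVec_le_of_active hM.1 hM.eigenvalues_nonneg _ (xs - x₀)
      fun i hμ _ => abs_eval_shiftedChebyshev_le_geometric hα hαβ m (hspec i hμ))

omit [Fintype k] [DecidableEq k] in
/-- The same in `M`-seminorms: `‖x_* − x_m‖_M ≤ 2((√κ'−1)/(√κ'+1))^m ‖x_* − x₀‖_M`.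
[cite: KahlRittich2017, §2 eq. (2.8); SaadEtAl2000, Theorem 4.3 eq. (4.4)] -/
theorem IsCGIterate.aNorm_le_geometric_of_posSemidef (hM : M.PosSemidef) {b x₀ xs x : ι → ℝ}
    {m : ℕ} (hx : IsCGIterate M b x₀ m x) (hb : M *ᵥ xs = b) {α β : ℝ} (hα : 0 < α)
    (hαβ : α < β) (hspec : ∀ i, hM.1.eigenvalues i ≠ 0 → hM.1.eigenvalues i ∈ Set.Icc α β) :
    aNorm M (xs - x) ≤
      2 * ((Real.sqrt (β / α) - 1) / (Real.sqrt (β / α) + 1)) ^ m * aNorm M (xs - x₀) := by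
  have hρ : 0 ≤ 2 * ((Real.sqrt (β / α) - 1) / (Real.sqrt (β / α) + 1)) ^ m := by
    have hκ : 1 ≤ Real.sqrt (β / α) := by
      rw [show (1 : ℝ) = Real.sqrt 1 by simp]
      exact Real.sqrt_le_sqrt (((one_lt_div hα).mpr hαβ).le)
    have : 0 ≤ (Real.sqrt (β / α) - 1) / (Real.sqrt (β / α) + 1) :=
      div_nonneg (by linarith) (by linarith)
    positivity
  have h := hx.aNormSq_le_geometric_of_posSemidef hM hb hα hαβ hspec
  rw [← aNorm_sq hM, ← aNorm_sq hM, ← mul_pow] at h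
  have hrhs : 0 ≤ 2 * ((Real.sqrt (β / α) - 1) / (Real.sqrt (β / α) + 1)) ^ m * aNorm M (xs - x₀) :=
    mul_nonneg hρ (aNorm_nonneg M _)
  exact (pow_le_pow_iff_left₀ (aNorm_nonneg M _) hrhs two_ne_zero).mp h

end Singular

section DeflatedSystem

variable {A : Matrix ι ι ℝ} {V : Matrix ι k ℝ}

/-- **The deflated system is consistent**: `(Aπ_R) x_* = π_L b` for `A x_* = b`.
[cite: KahlRittich2017, §2 Lemma 1 (iii); SaadEtAl2000, Theorem 4.6 (`HᵀAH x̃ = Hᵀ b`)] -/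
theorem mul_piR_mulVec_solution {b xs : ι → ℝ} (hb : A *ᵥ xs = b) :
    (A * piR A V Vᵀ) *ᵥ xs = piL A V Vᵀ *ᵥ b := by
  rw [mul_piR_eq_piL_mul, ← mulVec_mulVec, hb]

/-- **Reconstruction from a deflated iterate**: with `x_m := π_R x̂_m + V E⁻¹ Vᵀ b`
("`x = (I − π_A(𝒮)) x̂ + V(V^*AV)⁻¹V^* b`", "`x_j = H x̃_j + W y₀`") the error is
`x_* − x_m = π_R (x_* − x̂_m)`, so `‖x_* − x_m‖_A² = ‖x_* − x̂_m‖²` in the seminorm of the deflated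
matrix. [cite: KahlRittich2017, §2 eq. (2.7) with Lemma 1 (iv); SaadEtAl2000, Theorem 4.6] -/
theorem solution_sub_reconstruct {b xs : ι → ℝ} (hb : A *ᵥ xs = b) (xh : ι → ℝ) :
    xs - (piR A V Vᵀ *ᵥ xh + coarseCorrection A V Vᵀ *ᵥ b) = piR A V Vᵀ *ᵥ (xs - xh) := by
  conv_lhs => rw [eq_piR_mulVec_add (P := V) (Rs := Vᵀ) hb]
  rw [mulVec_sub]
  abel

/-- The error identity in `A`-norms: `‖x_* − (π_R x̂ + V E⁻¹ Vᵀ b)‖_A² = (x_* − x̂)ᵀ (Aπ_R) (x_* − x̂)`.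
[cite: KahlRittich2017, §2 Lemma 1 (ii) with eq. (2.7); SaadEtAl2000, Theorem 4.6
("`p̃ᵀ HᵀAH p̃ = (Hp̃)ᵀA(Hp̃)`")] -/
theorem aNormSq_solution_sub_reconstruct (hE : IsUnit (littleOp A V Vᵀ).det) (hA : A.IsHermitian)
    {b xs : ι → ℝ} (hb : A *ᵥ xs = b) (xh : ι → ℝ) :
    (xs - (piR A V Vᵀ *ᵥ xh + coarseCorrection A V Vᵀ *ᵥ b)) ⬝ᵥ A *ᵥ
        (xs - (piR A V Vᵀ *ᵥ xh + coarseCorrection A V Vᵀ *ᵥ b)) =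
      (xs - xh) ⬝ᵥ (A * piR A V Vᵀ) *ᵥ (xs - xh) := by
  rw [solution_sub_reconstruct hb, dotProduct_mul_piR_mulVec hE hA]

/-- Eigenvalues of the deflated matrix from its orthonormal eigenbasis: `(Aπ_R) u_i = μ_i u_i`,
and `u_i ≠ 0`. [folklore] -/
private theorem deflated_eigenpair (hM : (A * piR A V Vᵀ).IsHermitian) (i : ι) :
    (A * piR A V Vᵀ) *ᵥ (hM.eigenvectorBasis i).ofLp =
        hM.eigenvalues i • (hM.eigenvectorBasis i).ofLp ∧
      (hM.eigenvectorBasis i).ofLp ≠ 0 := by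
  refine ⟨hM.mulVec_eigenvectorBasis i, fun h => ?_⟩
  have h1 := KyFan.eigenvectorBasis_dotProduct hM i i
  rw [if_pos rfl, h, dotProduct_zero] at h1
  exact zero_ne_one h1

/-- **Deflated CG for a GENERAL deflation subspace — the rate with `κ_eff ≤ K/(1 − γ)`**
(Kahl–Rittich's Theorem 2 in the form of the error bound (2.8); Saad et al. Theorem 4.3/4.6 for
arbitrary `W`): let `A` be symmetric positive definite with eigenvalues `≤ β`, let the deflation
subspace `range V` (little operator invertible) satisfy the weak approximation property with
constant `C > 0` and the strengthened Cauchy–Schwarz inequality with `γ ∈ [0, 1)`, and put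
`α = (1 − γ)/C` (assume `α < β`). If `x̂_m` is the `m`-th CG (Galerkin–Krylov) iterate of the
consistent singular system `(Aπ_R) x̂ = π_L b` from any `x̂₀`, then the reconstructed iterates
`x_m = π_R x̂_m + V E⁻¹ Vᵀ b` satisfy `‖x_* − x_m‖_A ≤ 2((√κ'−1)/(√κ'+1))^m ‖x_* − x_0‖_A` with
`κ' = β/α = β C/(1 − γ)` (`= K/(1 − γ)` for `β = ‖A‖`). [cite: KahlRittich2017, §2 eq. (2.7)–(2.8),
§3 Theorem 1, Theorem 2; SaadEtAl2000, Theorem 4.3 eq. (4.4), Theorem 4.6] -/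
theorem IsCGIterate.aNorm_le_geometric_of_deflatedSystem (hE : IsUnit (littleOp A V Vᵀ).det)
    (hA : A.PosDef) {β C γ : ℝ} (hβ : ∀ i, hA.1.eigenvalues i ≤ β)
    (hC : 0 < C)
    (hwap : ∀ x : ι → ℝ, ∃ y : k → ℝ, (x - V *ᵥ y) ⬝ᵥ (x - V *ᵥ y) ≤ C * (x ⬝ᵥ A *ᵥ x))
    (hγ0 : 0 ≤ γ) (hγ1 : γ < 1)
    (hcbs : ∀ u : ι → ℝ, Vᵀ *ᵥ u = 0 → ∀ y : k → ℝ,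
      |u ⬝ᵥ A *ᵥ (V *ᵥ y)| ≤
        γ * Real.sqrt (u ⬝ᵥ A *ᵥ u) * Real.sqrt ((V *ᵥ y) ⬝ᵥ A *ᵥ (V *ᵥ y)))
    (hαβ : (1 - γ) / C < β) {b xs xh₀ xh : ι → ℝ} {m : ℕ} (hb : A *ᵥ xs = b)
    (hx : IsCGIterate (A * piR A V Vᵀ) (piL A V Vᵀ *ᵥ b) xh₀ m xh) :
    aNorm A (xs - (piR A V Vᵀ *ᵥ xh + coarseCorrection A V Vᵀ *ᵥ b)) ≤
      2 * ((Real.sqrt (β / ((1 - γ) / C)) - 1) / (Real.sqrt (β / ((1 - γ) / C)) + 1)) ^ m *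
        aNorm A (xs - (piR A V Vᵀ *ᵥ xh₀ + coarseCorrection A V Vᵀ *ᵥ b)) := by
  have hM : (A * piR A V Vᵀ).PosSemidef := posSemidef_mul_piR hE hA.posSemidef
  -- the non-zero spectrum of the deflated matrix lies in `[(1 − γ)/C, β]`
  have hspec : ∀ i, hM.1.eigenvalues i ≠ 0 → hM.1.eigenvalues i ∈ Set.Icc ((1 - γ) / C) β := by
    intro i hμ
    obtain ⟨hev, hne⟩ := deflated_eigenpair hM.1 i
    exact ⟨le_eigenvalue_mul_piR hE hA.posSemidef hwap hγ0 hγ1 hcbs hne hμ hev,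
      eigenvalue_mul_piR_le hE hA.posSemidef hβ hne hev⟩
  -- `α = (1 − γ)/C > 0`: a non-zero eigenvalue exists unless the bound is vacuous; get positivity
  -- from `hαβ` and the sign of the pieces
  have hα : 0 < (1 - γ) / C := div_pos (by linarith) hC
  have h1 := hx.aNorm_le_geometric_of_posSemidef hM (mul_piR_mulVec_solution hb) hα hαβ hspec
  have e0 : aNorm (A * piR A V Vᵀ) (xs - xh₀) =
      aNorm A (xs - (piR A V Vᵀ *ᵥ xh₀ + coarseCorrection A V Vᵀ *ᵥ b)) := by
    rw [aNorm, aNorm, aNormSq_solution_sub_reconstruct hE hA.1 hb]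
  have em : aNorm (A * piR A V Vᵀ) (xs - xh) =
      aNorm A (xs - (piR A V Vᵀ *ᵥ xh + coarseCorrection A V Vᵀ *ᵥ b)) := by
    rw [aNorm, aNorm, aNormSq_solution_sub_reconstruct hE hA.1 hb]
  rwa [e0, em] at h1

end DeflatedSystem

end ConjugateGradient

end Literature.Analysis.Matrix

end
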